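import Literature.MathematicalPhysics.QuantumFieldTheory.Balaban1983to89.B9SectBCodedChainR5
import Literature.MathematicalPhysics.QuantumFieldTheory.Balaban1983to89.B9SectBCodedChainR6
import Literature.MathematicalPhysics.QuantumFieldTheory.Balaban1983to89.B9SectBCodedChainR4
import Literature.MathematicalPhysics.QuantumFieldTheory.Balaban1983to89.B9SectBCodedChainR7
import Literature.MathematicalPhysics.QuantumFieldTheory.Balaban1983to89.B9GeoNormsKLevelModelSignsV1
import Literature.MathematicalPhysics.QuantumFieldTheory.Balaban1983to89.B9SectBStepUOfMembers
import Literature.MathematicalPhysics.QuantumFieldTheory.Balaban1983to89.B9SectBCodedClassR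

/-!
# `Balaban1983to89.B9SectBStepUOfMembersR` — THE CLASS-PARAMETRIC TWIN of `B9SectBStepUOfMembers` (CASCADE-R, director-ym №279 GO-R; №277 (3) `hunitA` cure; dag-n06-d SOCKET-(α) class question)

statement-level skeleton of published theorems with citation tags; proofs where landed; nothing here is a claim about the
Yang–Mills mass gap

WHAT THIS FILE IS.  The original module `B9SectBStepUOfMembers` types its objects over MODULE 3's member carrier `bg9Y 𝔸 G x` (MODULE 2's small-cube class (3.35)).  This file RE-DECLARES, with UNCHANGED NAMES inside the namespace `…B9SectBStepUOfMembersR`, exactly its 7 class-dependent declarations over the CLASS-PARAMETRIC carrier `B9SectBCodedClassR.bg9YC 𝔸 G P x` (`P : RegExtraY …` = the two cube conditions of (3.35)∕(3.36) as a parameter; `bg9Y 𝔸 G x = bg9YC 𝔸 G (extraY 𝔸 G) x` by `rfl`, so every declaration here that does NOT carry the `hunitA` binder specialises definitionally to its original; EXCEPTION (director-ym №288 (4) header audit; ref-E READ-9∕READ-13 HEADER-NIT species): the 4 declarations `stepGlobPos_KACU_frame_on`, `sectBStepU_of_members`, `thm34U_of_members`, `sectBStepU_C37GY_unitary_of_members`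 carry the №277 RE-KEYED `hunitA` (hypothesis «all (3.35)-regular U of the carrier», WEAKER than the original's «all G-valued U»), so at `P := extraY 𝔸 G` they IMPLY their originals through the adaptor `fun j α₀ U hU => hunitA j U hU.1.1` (kernel-checked composite, ref-E K3) and are NOT definitional specialisations; at the record's reading of PRINT's class, `P := extraYPb 𝔸 G`, the displayed laws `hreg335P` ((3.35) on plaquettes) and the class-keyed `hunitA` become theorems).  The text is the original's VERBATIM under the token surgery `bg9Y 𝔸 G ↦ bg9YC 𝔸 G P`, `NAME ↦ NAME P` for the class-dependent names (P the first explicit argument), and — №277 — the binder `hunitA` re-keyed from «all G-valued U» to «all (3.35)-regular U of the carrier» (`∀ j α₀ U, (bg9YC 𝔸 G P (f j)).Reg335 c35 α₀ U → IsUnit (deltaAY …)`), together with its use sites (`hunitA j U hU ↦ hunitA j α₀ U hU`) — hence NOT verbatim for the 4 declarations named above.  Class-free declarations of the original are NOT copied: they are imported and used BY NAME (`open … hiding` the re-declared ones).  Generated by dag-n06-c g16's `gen.py` (HOME `pub-ymgap-dag-n06-c/lean/g16/`); the ORIGINAL MODULE DOCUMENTATION FOLLOWS VERBATIM and describes the 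mathematics.

HONEST SCOPE.  Re-typing bookkeeping; nothing of [B9] asserted beyond the original; COUNT-NEUTRAL; N06 NOT discharged; nothing continuum ∕ OS ∕ mass gap ∕ Clay.  Cell `pub-ymgap` (D-0062), Track A node N06 [B9], seat `pub-ymgap-dag-n06-c` g16, 2026-08-29.
-/

/-!
# `Balaban1983to89.B9SectBStepUOfMembers` — THE ROW-13 TARGET OF RECORD `SectBStepU` (print's Sect. B step in U-LETTERS, R13-U1) and `Thm34U` PROVED at
# NODE 00's letters on a subfamily with sections, by ASSEMBLING dag-n06-c's landed block-steps (pub-ymgap N06, FLAG №8 (c): «the re-instantiated `SectBStepPrinted` landing»)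

T. Bałaban, *Propagators for lattice gauge theories in a background field*, Commun. Math. Phys. **99** (1985) 389–434 [`Balaban1985BackgroundPropagators`, "B9"],
Theorem 3.4 p. 400, Sect. B pp. 400–407 (p. 407: *«Thus Theorem 3.4 is proved, assuming that Theorems 3.1–3.3 hold»*), (3.35)–(3.37) p. 396, (3.42)–(3.48)
pp. 397–398; [4] = T. Bałaban, *Propagators and renormalization transformations for lattice gauge theories. II*, Commun. Math. Phys. **96** (1984) 223–250
[`Balaban1984PropagatorsII`], Lemma 2.1 p. 234, (2.45) p. 231, (2.51) p. 232.

statement-level skeleton of published theorems with citation tags; proofs where landed; nothing here is a claim about the Yang–Mills mass gap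

WHY THIS FILE (pub-ymgap N06 row 13; seat dag-n06-d gen 17; director-ym №215 (2)(c) «FLAG №8 closes on … n06-c's re-instantiated `Thm34Printed ∕ SectBStepPrinted`
landing …»; dag-n06-c g11 I.37469 / g12 / g15 I.46206 «assembly into `SectBStepU` (n06-d)»).  The W-letter row-13 display of the N06 certificates (`hB :
B9.SectBStepPrinted … (ops x).Gp (ops x).GA …` over `bg9Y`, transporters read at the complex product `U′U`) was LOCATED false-as-instantiated for `M_N(ℂ)`, `N ≧ 2`
(dag-n06-c LOCATED-11; node00-def-Y ruling R13-U1; №215 (2)).  The target of record since then is `B9SectBCodedReadingsU.SectBStepU`: print's Sect. B step with the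
letters at the base `U` and the operators at `U′U`, typed over dag-n06-c's CODED carrier `codingYx` with node00-def-Y's two-configuration readers `KSCU` (G′) ∕ `KACU`
(G).  dag-n06-c gens 11–15 landed EVERY member of it as a theorem (`StepEPos ∕ StepGlobPos ∕ StepL2Pos ∕ StepH1Pos ∕ StepE4Pos ∕ StepH2Pos ∕ StepKerPos ∕ StepAnalyticPos`
for `KSCU`; `StepEPos ∕ StepH1Pos ∕ StepE4Pos ∕ StepH2Pos ∕ StepL2Pos` for `KACU` through the frames `gFrame₅CodedOn ∕ h1GFrame₆CodedOn ∕ e4h2GFrame₆CodedOn ∕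
l2GFrame₈CodedOn`, with (3.77) in block-ℓ² PROVED, `read377L2_gFrame₅CodedOn`).  THIS FILE assembles them.

WHAT IS IN THE FILE (0 `def`, 0 `sorry`; standard axioms).
* §1 ★ `stepGlobPos_KACU_frame_on` — the (3.47) step of the bond family THROUGH THE FRAME (the frame's (3.42) step `stepEPos_KACU_frame_on` + dag-n06-c's
  `globBlock_KACU_prod_of_eBlock`, [4] Lemma 2.1): Route F's `stepGlobPos_KACU_of_385` with the frame's (3.42) step in place of the displayed (3.85) — NO (3.85) display.
* §2 ★ `stepPos_KSCU_of_KSC` — the G-side frame steps are stated with dag-n06-c's augmented reading `KSC` in the G′-INPUT slot; at a (3.35)-regular coded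
  configuration (a base) both input blocks are the record's read along the decoding (`B9SectBStepsKSCU.hin_KSCU_on_pos`), so every positive-input block-step
  moves to the `KSCU` input slot (`B9SectBStepPosFamilyTransfer.stepPos_of_family_pos`, identity output).
* §3 `thm32Printed_codedU`, ★ `thm33Printed_codedU` — the RECORD's Theorems 3.2 ∕ 3.3 (the step's printed premise) read over the coded carrier at
  `(KSCU, KACU, C⁻¹ ∘ dec)` ((3.35)-regular coded configurations are bases; `KSCU_members_base ∕ KACU_members_base`, `rfl`).
* §4 ★★★ `sectBStepU_of_members` — `SectBStepU f (d+1) c35 G b parSymY (GAY … parSymY parBY (GpY … parSymY)) parBY C37 C38 (CinvY … parSymY)` by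
  `B9SectBStepWhole.sectBStepPrinted_of_posBlockSteps` on the eight `KSCU` members + the six `KACU` members (§2-moved) + §3; the reversal law of `parSymY` by
  `Node00.parSymY_inv_symm`, `hparB ∕ hLipB` of `parBY` by dag-n06-c's `hparB_parBY ∕ hLipB_parBY`; ★★ `thm34U_of_members` (`B9.thm34_of_sectB`).
* §6 ★★★ `sectBStepU_C37GY_unitary_of_members` — `𝔸 = M_N(ℂ)`, `G ≦ U(N)`, coded class `C37 := C37GY` (dag-n06-c `B9SectBCodedClassGY`): the G′-side laws
  `hpar ∕ hunit ∕ hunitX` DISCHARGED (`Node00.parSymY_mem`, `isUnit_deltaPrimeAY_parSymY`, `isUnit_XY_parSymY` — Theorem 3.11's positivity) and the class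
  dictionaries `hC37 ∕ hC37G ∕ hvarB` DISCHARGED (projections).

DISPLAYED BY §6 (each a hypothesis of a landed member; nothing new): structural `hι` (sections of the block map on the subfamily — corner-free members have them,
`B9SectBCodedChainOnSubfamily`), `hG1`, a real basis `b` with `M₂ hrepr hcR hcL`, positivity data `MInv aInv aW`; the G-side law `hunitA` (`Δ_a(U)` invertible —
Theorem 3.1's input); `hb₁`, `C₀ hreg335P` ((3.35) on plaquettes; derivable over print's class `bg9YP`, dag-n06-j); cell numerics `hMd mN hnbr hMr`; the L² plaquette
law `hplaq`; the Lemma-2.1 datum `(d261, h261)` at the frames' threshold `M261`; the record's Theorems 3.2 ∕ 3.3 `h32 h33` (DERIVED in the N06 certificate from rows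
15–19); `C38` free.

HONEST SCOPE.  Composition of landed theorems; no estimate of the paper is proved here beyond what the members prove.  This is the U-letter Sect.-B step over
the CODED carrier; it does NOT give the W-letter `B9.SectBStepPrinted … (ops x).Gp …` over `bg9Y` displayed by the certificates of record (LOCATED-11: that
reading is not print's), and the N06 socket `B9LeafX (Y9OfRecord[P] … ops)` still types Theorem 3.4 in W-letters (Q-SOCKET, pub-ymgap bus 2026-08-29).
COUNT-NEUTRAL; N06 NOT discharged; one finite lattice programme at fixed `ε` — nothing continuum ∕ OS ∕ mass-gap ∕ Clay.  Cell `pub-ymgap` (HUMAN RULING D-0062),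
Track A node N06 [B9], row 13, 2026-08-29; `--supports stmt-QuantumFields-27364`.
-/

noncomputable section

namespace Literature.MathematicalPhysics.QuantumFieldTheory.Balaban1983to89.B9SectBStepUOfMembersR

open Literature.MathematicalPhysics.QuantumFieldTheory.Balaban1983to89.B9SectBCodedClassR (RegExtraY bg9YC)
open Literature.MathematicalPhysics.QuantumFieldTheory.Balaban1983to89.B9SectBStepUOfMembers hiding stepGlobPos_KACU_frame_on stepPos_KSCU_of_KSC thm32Printed_codedU thm33Printed_codedU sectBStepU_of_members thm34U_of_members sectBStepU_C37GY_unitary_of_members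

open B6Ineq2142KLevelV1 (β)
open B6RandomWalk (Ineq261)
open B9Thm34Ext (toB6)
open B9FromB6 (EBlock GlobBlock)
open B9PinMembersKLevelV1 (MemberY geo9Y bg9Y)
open B9Eq360DeltaPrimeAY (AfldY)
open B9SectBGpLettersY (GVal)
open B9SectBGpFrameCodedYR (codingYx)
open B9SectBGpFrameCodedY (CplxLettersY)
open B9SectBGpReadingsYR (KSC)
open B9SectBCodedCarrier (CCfg pullK pullS thm32Printed_coded thm33Printed_coded)
open B9SectBCodedReadingsUR (KSCU KACU SectBStepU Thm34U)
open B9SectBCodedChainAnR (IsAnKY)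
open B9SectBKerFrameCodedYR (CinvY)
open B9SectBStepWhole (StepPos StepEPos StepGlobPos StepL2Pos StepH1Pos StepE4Pos StepH2Pos StepKerPos StepAnalyticPos sectBStepPrinted_of_posBlockSteps)
open B9SectBStepPosFamilyTransfer (stepPos_of_family_pos stepPos_blk_of_family_pos)
open B9RWSumsReadsNbr (nbr)
open B9SectBGClassLettersY (Reg335PlaqY CplxLettersGY VarParBY)
open B9SectBGFrameCodedYR (gFrame₅CodedOn stepEPos_KACU_frame_on)
open B9SectBGStepCodedFGlobR (globBlock_KACU_prod_of_eBlock globBlock_mono_const)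
open B9SectBH1GFrameCodedYR (h1GFrame₆CodedOn)
open B9Eq340HolderLipParBYR (hLipB_parBY stepH1Pos_KACU_frame_parBY_on)
open B9Eq340HolderLipParBY (hparB_parBY)
open B9Eq340TaxiContourLocalityY (rLB rLB_nonneg)
open B9SectBE4H2GFrameCodedYR (e4h2GFrame₆CodedOn stepE4Pos_KACU_frame_on stepH2Pos_KACU_frame_on)
open B9SectBL2GFrameCodedY (Read377L2)
open B9SectBL2SecondOrderY (PlaqLawY)
open B9SectBL2GFrameCodedV8YR (stepL2Pos_KACU_frame₈_on)
open B9SectBL2GRead377YR (read377L2_gFrame₅CodedOn)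
open B9SectBCodedClassGY (C37GY hC37_of_C37GY hC37G_of_C37GY hvarB_of_C37GY)
open B9Eq359VarParBY (cVarGY cVarGY_nonneg)
open B9SectBStepsKSCUR (hin_KSCU_on_pos stepAnalyticPos_KSCU_on KSCU_members_base KACU_members_base ineq342_346_347_congr)
open B9SectBGpTransferInYR (ineq343_345_congr)
open B9SectBStepsKSCUBlocksR (stepEPos_KSCU_on stepGlobPos_KSCU_on stepL2Pos_KSCU_on)
open B9Eq340HolderLipParSymYR (stepH1Pos_KSCU_parSymY_on)
open B9SectBE4FrameCodedYR (stepE4Pos_KSCU_on)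
open B9SectBH2FrameCodedYR (stepH2Pos_KSCU_on)
open B9SectBKerStepParSymYR (stepKerPos_KSCU_parSymY_on)
open B9GeoNormsKLevelModelSignsV1 (modelSignsOn_geo9K)
open Node00 (SiteY BlkY FBondY IBondY CfgY SiteParY BondParY BondOpY GAY GpY XY deltaAY deltaPrimeAY parSymY parBY parSymY_inv_symm kernelFamilyS kernelFamilyB)

variable {d ℓ : ℕ} {hd : 1 ≤ d + 1} {hL : Odd (ℓ + 1) ∧ 1 < ℓ + 1} {b₀ b₁ : ℝ} {Mstar : ℕ}

section General

variable {𝔸 : Type} [NormedRing 𝔸] (P : RegExtraY d ℓ hd hL b₀ b₁ Mstar 𝔸) [NormedAlgebra ℂ 𝔸] [CompleteSpace 𝔸] [NormOneClass 𝔸] [FiniteDimensional ℝ 𝔸]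
  {J : Type} (f : J → MemberY d ℓ hd hL b₀ b₁ Mstar) [∀ x : MemberY d ℓ hd hL b₀ b₁ Mstar, Fintype (geo9Y x).Site]
  [instDS : ∀ x : MemberY d ℓ hd hL b₀ b₁ Mstar, DecidableEq (geo9Y x).Site] [instNE : ∀ x : MemberY d ℓ hd hL b₀ b₁ Mstar, Nonempty (geo9Y x).Site]
  (c35 : ℝ) (G : Subgroup 𝔸ˣ) {ι : Type} [Fintype ι] [DecidableEq ι] (b : Module.Basis ι ℝ 𝔸)
  (ιB : ∀ j : J, BlkY (f j).toKIdx → IBondY (f j).toKIdx)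
  (C38 : ∀ j : J, ℝ → CfgY 𝔸 (f j).toKIdx → AfldY 𝔸 (f j).toKIdx → Prop)

/-! ## §1 ★ The frame-route (3.47) step of the bond family `KACU` (no (3.85) display) -/

section Glob

variable (par : ∀ j : J, SiteParY 𝔸 (f j).toKIdx) (parB : ∀ j : J, BondParY 𝔸 (f j).toKIdx)
  (C37 : ∀ j : J, ℝ → CfgY 𝔸 (f j).toKIdx → AfldY 𝔸 (f j).toKIdx → Prop)

/-- ★ **`StepGlobPos` OF THE CODED BOND FAMILY `KACU` THROUGH THE G FRAME**: the frame's (3.42) step `stepEPos_KACU_frame_on` followed, at every coded product,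
by dag-n06-c's «(3.42) block ⟹ (3.47) block» (`globBlock_KACU_prod_of_eBlock`, [4] Lemma 2.1) — the proof of Route F's `stepGlobPos_KACU_of_385` with the
frame's (3.42) step in place of the displayed (3.85); displayed: exactly the binders of `stepEPos_KACU_frame_on`.
[cite: Balaban1985BackgroundPropagators, Thm 3.4 p.400, (3.47) p.398 («consequences of the local ones (3.42) and Lemma 2.1»), (3.82)–(3.86) p.407; Balaban1984PropagatorsII, Lemma 2.1 p.234, (2.51) p.232] -/
theorem stepGlobPos_KACU_frame_on (hι : ∀ (j : J) (s : BlkY (f j).toKIdx), β (f j).toKIdx.hN (f j).toKIdx.D (f j).toKIdx.hk (ιB j s) = s)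
    (hG1 : ∀ u : 𝔸ˣ, u ∈ G → ‖(u : 𝔸)‖ ≤ 1) (hpar : ∀ j (U : CfgY 𝔸 (f j).toKIdx), GVal G (f j).toKIdx U → ∀ z w, par j U z w ∈ G)
    (hunit : ∀ j (U : CfgY 𝔸 (f j).toKIdx), GVal G (f j).toKIdx U → IsUnit (deltaPrimeAY (f j).toKIdx (par j) U))
    (M₂ : ℝ) (hM₂ : 0 ≤ M₂) (hrepr : ∀ (v : 𝔸) (j : ι), |b.repr v j| ≤ M₂ * ‖v‖) (hcR : 0 < M₂ * ∑ j, ‖b j‖)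
    (Cq : ℝ) (hCq : 0 ≤ Cq) (hC37 : ∀ j β' U a, C37 j β' U a → GVal G (f j).toKIdx U ∧ CplxLettersY G (f j) (par j) (ιB j) Cq β' U a)
    (MInv aInv aW : ℝ) (hMInv : 0 < MInv) (haInv : 0 < aInv) (haW : 0 < aW)
    (hunitX : ∀ j (U : CfgY 𝔸 (f j).toKIdx), GVal G (f j).toKIdx U → IsUnit (XY (f j).toKIdx (par j) (GpY (f j).toKIdx (par j)) U))
    (hsym : ∀ j (U : CfgY 𝔸 (f j).toKIdx) (z w : SiteY (f j).toKIdx), par j U z w = (par j U w z)⁻¹)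
    (hunitA : ∀ j (α₀ : ℝ) (U : CfgY 𝔸 (f j).toKIdx), (bg9YC 𝔸 G P (f j)).Reg335 c35 α₀ U → IsUnit (deltaAY (f j).toKIdx (par j) (parB j) (GpY (f j).toKIdx (par j)) U))
    (hparB : ∀ j (U : CfgY 𝔸 (f j).toKIdx), GVal G (f j).toKIdx U → ∀ y f', parB j U y f' ∈ G) (hb₁ : 0 ≤ b₁)
    (C₀ : ℝ) (hC₀ : 0 ≤ C₀)
    (hreg335P : ∀ j (α₀ : ℝ) (U : CfgY 𝔸 (f j).toKIdx), MInv ≤ (geo9Y (f j)).M → 0 < α₀ → (geo9Y (f j)).M * α₀ ≤ aInv →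
      (bg9YC 𝔸 G P (f j)).Reg335 c35 α₀ U → Reg335PlaqY G (f j) (ιB j) C₀ U)
    (hC37G : ∀ j β' U a, C37 j β' U a → CplxLettersGY G (f j) (ιB j) β' U a)
    (cVar : ℝ) (hcVar : 0 ≤ cVar) (hvarB : ∀ j β' U a, C37 j β' U a → VarParBY (f j).toKIdx (parB j) cVar β' U a)
    (hMd : 2 * ((d : ℝ) + 1) < MInv) (mN : ℕ) (hnbr : ∀ (j : J) (y' : IBondY (f j).toKIdx), (nbr (geo9Y (f j)) (2 * ((d : ℝ) + 1)) y').card ≤ mN)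
    (d261 : ℝ → ℕ)
    (h261 : ∀ (j : J) (δ α : ℝ), 0 < δ → δ ≤ 1 → 9 / 5000 ≤ α → α < 1 →
      (gFrame₅CodedOn P f c35 G par parB b ιB C37 C38 hι hG1 hpar hunit M₂ hM₂ hrepr hcR Cq hCq hC37 MInv aInv aW hMInv haInv haW hunitX hsym hunitA hparB hb₁ C₀
        hC₀ hreg335P hC37G cVar hcVar hvarB hMd mN hnbr).M261 δ ≤ (geo9Y (f j)).M →
      Ineq261 (d261 δ) (toB6 (geo9Y (f j)) 0 True) δ α) :
    StepGlobPos (d + 1) c35 (fun j => geo9Y (f j)) (fun j => (codingYx P G (f j) (C37 j) (C38 j)).bg) (fun j => KSC P G (f j) (par j) (C37 j) (C38 j))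
      (fun j => KACU P G (f j) (GAY (f j).toKIdx (par j) (parB j) (GpY (f j).toKIdx (par j))) (parB j) (C37 j) (C38 j))
      (fun j => pullS (codingYx P G (f j) (C37 j) (C38 j)) (CinvY P f G par j))
      (fun j => KACU P G (f j) (GAY (f j).toKIdx (par j) (parB j) (GpY (f j).toKIdx (par j))) (parB j) (C37 j) (C38 j)) := by
  refine stepPos_blk_of_family_pos (d + 1) c35 (fun j => geo9Y (f j)) (fun j => (codingYx P G (f j) (C37 j) (C38 j)).bg)
    (fun j => KSC P G (f j) (par j) (C37 j) (C38 j)) (fun j => KSC P G (f j) (par j) (C37 j) (C38 j))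
    (fun j => KACU P G (f j) (GAY (f j).toKIdx (par j) (parB j) (GpY (f j).toKIdx (par j))) (parB j) (C37 j) (C38 j))
    (fun j => KACU P G (f j) (GAY (f j).toKIdx (par j) (parB j) (GpY (f j).toKIdx (par j))) (parB j) (C37 j) (C38 j))
    (fun j => pullS (codingYx P G (f j) (C37 j) (C38 j)) (CinvY P f G par j))
    (C₁ := ℝ × ℝ) (C₂ := ℝ) (pos₁ := fun c => 0 < c.1 ∧ 0 < c.2) (pos₂ := fun c => 0 < c)
    (Blk₁ := fun c j W => EBlock (KACU P G (f j) (GAY (f j).toKIdx (par j) (parB j) (GpY (f j).toKIdx (par j))) (parB j) (C37 j) (C38 j)) c.1 c.2 W)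
    (Blk₂ := fun c j W => GlobBlock (KACU P G (f j) (GAY (f j).toKIdx (par j) (parB j) (GpY (f j).toKIdx (par j))) (parB j) (C37 j) (C38 j)) c W)
    (fun B₀ δ₀ Bβ Bε Bεβ B₁ δ₁ hB₀ hδ₀ hB₁ hδ₁ =>
      ⟨0, 1, B₀, δ₀, Bβ, Bε, Bεβ, B₁, δ₁, one_pos, hB₀, hδ₀, hB₁, hδ₁, fun _ _ _ _ _ _ _ hT => hT⟩)
    (fun c hc a ha => ?_)
    (stepEPos_KACU_frame_on P f c35 G par parB b ιB C37 C38 hι hG1 hpar hunit M₂ hM₂ hrepr hcR Cq hCq hC37 MInv aInv aW hMInv haInv haW hunitX hsym hunitA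
      hparB hb₁ C₀ hC₀ hreg335P hC37G cVar hcVar hvarB hMd mN hnbr d261 h261)
  obtain ⟨Mg, Cg, hCg, H⟩ := globBlock_KACU_prod_of_eBlock P (𝔸 := 𝔸) (d := d) (ℓ := ℓ) (hd := hd) (hL := hL) (b₀ := b₀) (b₁ := b₁) (Mstar := Mstar) G hc.2
  refine ⟨Mg, 1, a, c.1 * (Cg + 1), one_pos, ha, le_rfl, mul_pos hc.1 (by linarith), ?_⟩
  intro j hM α₀ hα₀ _ W hreg α₁ _ _ W' h37 hE
  obtain ⟨U, rfl, -⟩ := (codingYx P G (f j) (C37 j) (C38 j)).exists_of_bg_Reg335 hreg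
  obtain ⟨U', a', hcU, rfl, -⟩ := (codingYx P G (f j) (C37 j) (C38 j)).exists_of_bg_Cplx337 h37
  cases hcU
  have hG := H (f j) (ιB j) (hι j) hM (GAY (f j).toKIdx (par j) (parB j) (GpY (f j).toKIdx (par j))) (parB j) (C37 j) (C38 j) U a' c.1 hc.1.le hE
  exact globBlock_mono_const P G (f j) _ (parB j) (C37 j) (C38 j) hG (mul_le_mul_of_nonneg_left (by linarith) hc.1.le)

end Glob

/-! ## §2 The G-side frame steps moved from the augmented `KSC` input slot to the U-letter `KSCU` input slot -/

section ToU

variable (par : ∀ j : J, SiteParY 𝔸 (f j).toKIdx) (OA : ∀ j : J, BondOpY 𝔸 (f j).toKIdx) (parB : ∀ j : J, BondParY 𝔸 (f j).toKIdx)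
  (C37 : ∀ j : J, ℝ → CfgY 𝔸 (f j).toKIdx → AfldY 𝔸 (f j).toKIdx → Prop)
  (Cinv : ∀ j : J, B9.SiteKernel (geo9Y (f j)) (bg9YC 𝔸 G P (f j)))

omit [NormOneClass 𝔸] [FiniteDimensional ℝ 𝔸] instDS instNE [DecidableEq ι] in
/-- ★ **INPUT TRANSFER `KSC → KSCU` FOR ANY POSITIVE-INPUT BLOCK-STEP**: a step stated with dag-n06-c's augmented coded reading `KSC` in the G′-input slot
(the G-side frame members) holds with the U-letter reading `KSCU` there — at a (3.35)-regular coded configuration (a base) both input blocks are the record's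
Theorem 3.1–3.3 block read along the decoding (`B9SectBStepsKSCU.hin_KSCU_on_pos`); the output is untouched.
[cite: Balaban1985BackgroundPropagators, Thm 3.4 p.400, Thms 3.1–3.3 (3.42)–(3.48) pp.397–399, (3.35) p.396; Balaban1984PropagatorsII, (2.51) p.232] -/
theorem stepPos_KSCU_of_KSC {C : Type} {pos : C → Prop}
    {Out : C → ∀ j : J, (codingYx P G (f j) (C37 j) (C38 j)).bg.Cfg → ℝ → Prop}
    (hι : ∀ (j : J) (s : BlkY (f j).toKIdx), β (f j).toKIdx.hN (f j).toKIdx.D (f j).toKIdx.hk (ιB j s) = s)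
    (hG1 : ∀ u : 𝔸ˣ, u ∈ G → ‖(u : 𝔸)‖ ≤ 1) {M₂ : ℝ} (hM₂ : 0 ≤ M₂) (hrepr : ∀ (v : 𝔸) (j : ι), |b.repr v j| ≤ M₂ * ‖v‖) (dC : ℕ)
    (h : StepPos dC c35 (fun j => geo9Y (f j)) (fun j => (codingYx P G (f j) (C37 j) (C38 j)).bg) (fun j => KSC P G (f j) (par j) (C37 j) (C38 j))
      (fun j => KACU P G (f j) (OA j) (parB j) (C37 j) (C38 j)) (fun j => pullS (codingYx P G (f j) (C37 j) (C38 j)) (Cinv j)) C pos Out) :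
    StepPos dC c35 (fun j => geo9Y (f j)) (fun j => (codingYx P G (f j) (C37 j) (C38 j)).bg) (fun j => KSCU P G (f j) (par j) (C37 j) (C38 j))
      (fun j => KACU P G (f j) (OA j) (parB j) (C37 j) (C38 j)) (fun j => pullS (codingYx P G (f j) (C37 j) (C38 j)) (Cinv j)) C pos Out :=
  stepPos_of_family_pos dC c35 (fun j => geo9Y (f j)) (fun j => (codingYx P G (f j) (C37 j) (C38 j)).bg) (fun j => KSC P G (f j) (par j) (C37 j) (C38 j))
    (fun j => KSCU P G (f j) (par j) (C37 j) (C38 j)) (fun j => KACU P G (f j) (OA j) (parB j) (C37 j) (C38 j)) (fun j => KACU P G (f j) (OA j) (parB j) (C37 j) (C38 j))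
    (fun j => pullS (codingYx P G (f j) (C37 j) (C38 j)) (Cinv j)) (hin_KSCU_on_pos P f c35 G par OA parB b ιB C37 C38 Cinv hι hG1 hM₂ hrepr dC)
    (fun c hc a ha => ⟨0, 1, a, c, one_pos, ha, le_rfl, hc, fun _ _ _ _ _ _ _ _ _ _ h' => h'⟩) h

end ToU

/-! ## §3 Theorems 3.2 ∕ 3.3 of the record, read over the coded carrier at `(KSCU, KACU, C⁻¹ ∘ dec)` (the step's printed premise, p.407) -/

section Inputs

variable (par : ∀ j : J, SiteParY 𝔸 (f j).toKIdx) (OA : ∀ j : J, BondOpY 𝔸 (f j).toKIdx) (parB : ∀ j : J, BondParY 𝔸 (f j).toKIdx)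
  (C37 : ∀ j : J, ℝ → CfgY 𝔸 (f j).toKIdx → AfldY 𝔸 (f j).toKIdx → Prop)
  (Cinv : ∀ j : J, B9.SiteKernel (geo9Y (f j)) (bg9YC 𝔸 G P (f j)))

omit [NormOneClass 𝔸] [FiniteDimensional ℝ 𝔸] [∀ x : MemberY d ℓ hd hL b₀ b₁ Mstar, Fintype (geo9Y x).Site] instDS instNE [Fintype ι] [DecidableEq ι] in
/-- Theorem 3.2 of the record at the members `f j` gives Theorem 3.2 over the coded carriers for the kernel read along the decoding (`thm32Printed_coded`).
[cite: Balaban1985BackgroundPropagators, Thm 3.2 (3.48) p.398, (3.35) p.396] -/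
theorem thm32Printed_codedU (dC : ℕ) (h32 : B9.Thm32Printed dC c35 (fun j => geo9Y (f j)) (fun j => bg9YC 𝔸 G P (f j)) Cinv) :
    B9.Thm32Printed dC c35 (fun j => geo9Y (f j)) (fun j => (codingYx P G (f j) (C37 j) (C38 j)).bg)
      (fun j => pullS (codingYx P G (f j) (C37 j) (C38 j)) (Cinv j)) :=
  thm32Printed_coded dC c35 (fun j => geo9Y (f j)) (fun j => bg9YC 𝔸 G P (f j)) (fun j => codingYx P G (f j) (C37 j) (C38 j)) Cinv h32

omit [NormOneClass 𝔸] [FiniteDimensional ℝ 𝔸] [∀ x : MemberY d ℓ hd hL b₀ b₁ Mstar, Fintype (geo9Y x).Site] instDS instNE [Fintype ι] [DecidableEq ι] in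
/-- ★ Theorem 3.3 of the record for `(G′, G)` read by `kernelFamilyS … (GpY par) par ∕ kernelFamilyB … OA parB` gives Theorem 3.3 over the coded carriers for
`(KSCU, KACU)`: (3.35)-regular coded configurations are bases, where the U-letter readings ARE the record's (`KSCU_members_base ∕ KACU_members_base`, `rfl`).
[cite: Balaban1985BackgroundPropagators, Thm 3.3 p.399, Thm 3.1 (3.42)–(3.47) pp.397–398, (3.35) p.396] -/
theorem thm33Printed_codedU
    (h33 : B9.Thm33Printed c35 (fun j => geo9Y (f j)) (fun j => bg9YC 𝔸 G P (f j))
      (fun j => kernelFamilyS (f j).toKIdx (bg9YC 𝔸 G P (f j)) (fun U => U) (GpY (f j).toKIdx (par j)) (par j))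
      (fun j => kernelFamilyB (f j).toKIdx (bg9YC 𝔸 G P (f j)) (fun U => U) (OA j) (parB j))) :
    B9.Thm33Printed c35 (fun j => geo9Y (f j)) (fun j => (codingYx P G (f j) (C37 j) (C38 j)).bg) (fun j => KSCU P G (f j) (par j) (C37 j) (C38 j))
      (fun j => KACU P G (f j) (OA j) (parB j) (C37 j) (C38 j)) := by
  obtain ⟨M₁, δ₀, a₀, B₀, Bβ, Bε, Bεβ, hM₁, hδ₀, ha₀, hB₀, H⟩ :=
    thm33Printed_coded c35 (fun j => geo9Y (f j)) (fun j => bg9YC 𝔸 G P (f j)) (fun j => codingYx P G (f j) (C37 j) (C38 j)) _ _ h33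
  refine ⟨M₁, δ₀, a₀, B₀, Bβ, Bε, Bεβ, hM₁, hδ₀, ha₀, hB₀, fun j hM α₀ hα₀ hMα c hc => ?_⟩
  obtain ⟨U, rfl, -⟩ := (codingYx P G (f j) (C37 j) (C38 j)).exists_of_bg_Reg335 hc
  obtain ⟨⟨h42, h43⟩, ⟨g42, g43⟩⟩ := H j hM α₀ hα₀ hMα _ hc
  obtain ⟨se, sh1, se4, sh2, sl2, sg⟩ := KSCU_members_base P G (f j) (par j) (C37 j) (C38 j) U
  obtain ⟨ae, ah1, ae4, ah2, al2, ag⟩ := KACU_members_base P G (f j) (OA j) (parB j) (C37 j) (C38 j) U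
  exact ⟨⟨ineq342_346_347_congr P G (f j) (C37 j) (C38 j) _ _ (fun n => (se n).symm) (fun n => (sl2 n).symm) (fun n => (sg n).symm) B₀ δ₀ h42,
      ineq343_345_congr P G (f j) (C37 j) (C38 j) _ _ sh1.symm se4.symm sh2.symm Bβ Bε Bεβ δ₀ h43⟩,
    ⟨ineq342_346_347_congr P G (f j) (C37 j) (C38 j) _ _ (fun n => (ae n).symm) (fun n => (al2 n).symm) (fun n => (ag n).symm) B₀ δ₀ g42,
      ineq343_345_congr P G (f j) (C37 j) (C38 j) _ _ ah1.symm ae4.symm ah2.symm Bβ Bε Bεβ δ₀ g43⟩⟩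

end Inputs

/-! ## §4 ★★★ `SectBStepU` at NODE 00's letters (`parSymY`, `GAY … parBY`, `parBY`, `CinvY … parSymY`), assembled from the sixteen members -/

section Assembly

variable (C37 : ∀ j : J, ℝ → CfgY 𝔸 (f j).toKIdx → AfldY 𝔸 (f j).toKIdx → Prop)

/-- ★★★ **THE ROW-13 TARGET OF RECORD `SectBStepU` — print's Sect. B step («Thus Theorem 3.4 is proved, assuming that Theorems 3.1–3.3 hold», p.407) in
U-LETTERS (letters at the base `U`, operators at the product `U′U`; node00-def-Y's ruling R13-U1 on dag-n06-c's LOCATED-11) — PROVED on a subfamily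
`f : J → MemberY` with sections `ιB` AT NODE 00's LETTERS**: transporters `par := parSymY` (reversal law by `Node00.parSymY_inv_symm`), bond letters
`OA := GAY … (parSymY) (parBY) (GpY … parSymY)`, `parB := parBY` (`hparB` by `hparB_parBY`, the bond Lipschitz law `hLipB` by `hLipB_parBY`), C⁻¹ kernel `CinvY … parSymY`,
analyticity pin `IsAnKY`; ASSEMBLED by `B9SectBStepWhole.sectBStepPrinted_of_posBlockSteps` from dag-n06-c's landed members — G′ side (`KSCU`):
`stepEPos ∕ stepGlobPos ∕ stepL2Pos_KSCU_on`, `stepH1Pos_KSCU_parSymY_on`, `stepE4Pos ∕ stepH2Pos_KSCU_on`, `stepKerPos_KSCU_parSymY_on`, `stepAnalyticPos_KSCU_on`;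
G side (`KACU`, through the frames `gFrame₅CodedOn ∕ h1GFrame₆CodedOn ∕ e4h2GFrame₆CodedOn ∕ l2GFrame₈CodedOn`): `stepEPos_KACU_frame_on`, §1 `stepGlobPos_KACU_frame_on`,
`stepH1Pos_KACU_frame_parBY_on`, `stepE4Pos ∕ stepH2Pos_KACU_frame_on`, `stepL2Pos_KACU_frame₈_on … (read377L2_gFrame₅CodedOn …)` ((3.77) in block-ℓ² PROVED there),
each moved to the `KSCU` input slot by §2.  DISPLAYED (the union of the members' binders, nothing new): structural `hι hG1 b M₂ hrepr hcR hcL`, the positivity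
data `MInv aInv aW`, the G′-side laws `hpar hunit hunitX` (facts of the matrix algebra at `parSymY`, discharged for `G ≦ U(N)` in `…_unitary`-type corollaries:
`Node00.parSymY_mem`, `isUnit_deltaPrimeAY_parSymY`, `isUnit_XY_parSymY`), the coded-class dictionaries `hC37 hC37G hvarB` (projections for `C37 := C37GY`,
`sectBStepU_C37GY_of_members`), the G-side laws `hunitA` (Theorem 3.1's input: `Δ_a(U)` invertible), `hb₁ C₀ hreg335P` ((3.35) on plaquettes), the cell numerics
`hMd mN hnbr hMr`, the L² plaquette law `hplaq`, the Lemma-2.1 datum `(d261, h261)` at the frames' threshold, and the RECORD's Theorems 3.2 ∕ 3.3 `h32 h33`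
(the step's printed premise). [cite: Balaban1985BackgroundPropagators, Thm 3.4 p.400, Sect. B (3.50)–(3.86) pp.400–407, p.403 l.1–9, p.407 («Thus Theorem 3.4 is proved, assuming that Theorems 3.1–3.3 hold»), Thms 3.1–3.3 (3.42)–(3.48) pp.397–399, (3.35)–(3.37) p.396, (3.77) p.406; Balaban1984PropagatorsII, Lemma 2.1 p.234, (2.45) p.231, (2.51) p.232] -/
theorem sectBStepU_of_members (hι : ∀ (j : J) (s : BlkY (f j).toKIdx), β (f j).toKIdx.hN (f j).toKIdx.D (f j).toKIdx.hk (ιB j s) = s)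
    (hG1 : ∀ u : 𝔸ˣ, u ∈ G → ‖(u : 𝔸)‖ ≤ 1)
    (hpar : ∀ j (U : CfgY 𝔸 (f j).toKIdx), GVal G (f j).toKIdx U → ∀ z w, parSymY (f j).toKIdx U z w ∈ G)
    (hunit : ∀ j (U : CfgY 𝔸 (f j).toKIdx), GVal G (f j).toKIdx U → IsUnit (deltaPrimeAY (f j).toKIdx (parSymY (f j).toKIdx) U))
    (M₂ : ℝ) (hM₂ : 0 ≤ M₂) (hrepr : ∀ (v : 𝔸) (j : ι), |b.repr v j| ≤ M₂ * ‖v‖) (hcR : 0 < M₂ * ∑ j, ‖b j‖)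
    (hcL : 0 < Real.sqrt (Fintype.card ι) * M₂ * ∑ j, ‖b j‖)
    (Cq : ℝ) (hCq : 0 ≤ Cq)
    (hC37 : ∀ j β' U a, C37 j β' U a → GVal G (f j).toKIdx U ∧ CplxLettersY G (f j) (parSymY (f j).toKIdx) (ιB j) Cq β' U a)
    (MInv aInv aW : ℝ) (hMInv : 0 < MInv) (haInv : 0 < aInv) (haW : 0 < aW)
    (hunitX : ∀ j (U : CfgY 𝔸 (f j).toKIdx), GVal G (f j).toKIdx U →
      IsUnit (XY (f j).toKIdx (parSymY (f j).toKIdx) (GpY (f j).toKIdx (parSymY (f j).toKIdx)) U))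
    (hunitA : ∀ j (α₀ : ℝ) (U : CfgY 𝔸 (f j).toKIdx), (bg9YC 𝔸 G P (f j)).Reg335 c35 α₀ U →
      IsUnit (deltaAY (f j).toKIdx (parSymY (f j).toKIdx) (parBY (f j).toKIdx) (GpY (f j).toKIdx (parSymY (f j).toKIdx)) U)) (hb₁ : 0 ≤ b₁)
    (C₀ : ℝ) (hC₀ : 0 ≤ C₀)
    (hreg335P : ∀ j (α₀ : ℝ) (U : CfgY 𝔸 (f j).toKIdx), MInv ≤ (geo9Y (f j)).M → 0 < α₀ → (geo9Y (f j)).M * α₀ ≤ aInv →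
      (bg9YC 𝔸 G P (f j)).Reg335 c35 α₀ U → Reg335PlaqY G (f j) (ιB j) C₀ U)
    (hC37G : ∀ j β' U a, C37 j β' U a → CplxLettersGY G (f j) (ιB j) β' U a)
    (cVar : ℝ) (hcVar : 0 ≤ cVar) (hvarB : ∀ j β' U a, C37 j β' U a → VarParBY (f j).toKIdx (parBY (f j).toKIdx) cVar β' U a)
    (hMd : 2 * ((d : ℝ) + 1) < MInv) (mN : ℕ) (hnbr : ∀ (j : J) (y' : IBondY (f j).toKIdx), (nbr (geo9Y (f j)) (2 * ((d : ℝ) + 1)) y').card ≤ mN)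
    (hMr : rLB d ℓ + 1 < MInv) {cP : ℝ} (hcP : 0 ≤ cP)
    (hplaq : ∀ (j : J) (α₀ : ℝ) (U : CfgY 𝔸 (f j).toKIdx), (bg9YC 𝔸 G P (f j)).Reg335 c35 α₀ U → PlaqLawY (f j) (ιB j) cP U)
    (d261 : ℝ → ℕ)
    (h261 : ∀ (j : J) (δ α : ℝ), 0 < δ → δ ≤ 1 → 9 / 5000 ≤ α → α < 1 →
      (gFrame₅CodedOn P f c35 G (fun j => parSymY (f j).toKIdx) (fun j => parBY (f j).toKIdx) b ιB C37 C38 hι hG1 hpar hunit M₂ hM₂ hrepr hcR Cq hCq hC37 MInv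
        aInv aW hMInv haInv haW hunitX (fun _ U z w => parSymY_inv_symm U z w) hunitA (hparB_parBY f G) hb₁ C₀ hC₀ hreg335P hC37G cVar hcVar hvarB hMd mN
        hnbr).M261 δ ≤ (geo9Y (f j)).M →
      Ineq261 (d261 δ) (toB6 (geo9Y (f j)) 0 True) δ α)
    (h32 : B9.Thm32Printed (d + 1) c35 (fun j => geo9Y (f j)) (fun j => bg9YC 𝔸 G P (f j)) (CinvY P f G (fun j => parSymY (f j).toKIdx)))
    (h33 : B9.Thm33Printed c35 (fun j => geo9Y (f j)) (fun j => bg9YC 𝔸 G P (f j))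
      (fun j => kernelFamilyS (f j).toKIdx (bg9YC 𝔸 G P (f j)) (fun U => U) (GpY (f j).toKIdx (parSymY (f j).toKIdx)) (parSymY (f j).toKIdx))
      (fun j => kernelFamilyB (f j).toKIdx (bg9YC 𝔸 G P (f j)) (fun U => U)
        (GAY (f j).toKIdx (parSymY (f j).toKIdx) (parBY (f j).toKIdx) (GpY (f j).toKIdx (parSymY (f j).toKIdx))) (parBY (f j).toKIdx))) :
    SectBStepU P f (d + 1) c35 G b (fun j => parSymY (f j).toKIdx)
      (fun j => GAY (f j).toKIdx (parSymY (f j).toKIdx) (parBY (f j).toKIdx) (GpY (f j).toKIdx (parSymY (f j).toKIdx))) (fun j => parBY (f j).toKIdx)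
      C37 C38 (CinvY P f G (fun j => parSymY (f j).toKIdx)) := by
  have hsym : ∀ j (U : CfgY 𝔸 (f j).toKIdx) (z w : SiteY (f j).toKIdx), parSymY (f j).toKIdx U z w = (parSymY (f j).toKIdx U w z)⁻¹ :=
    fun _ U z w => parSymY_inv_symm U z w
  -- the G side: six frame steps at the `KSC` input slot, moved to the `KSCU` slot (§2)
  have hEa := stepPos_KSCU_of_KSC P f c35 G b ιB C38 (fun j => parSymY (f j).toKIdx) _ (fun j => parBY (f j).toKIdx) C37 _ hι hG1 hM₂ hrepr (d + 1)
    (stepEPos_KACU_frame_on P f c35 G (fun j => parSymY (f j).toKIdx) (fun j => parBY (f j).toKIdx) b ιB C37 C38 hι hG1 hpar hunit M₂ hM₂ hrepr hcR Cq hCq hC37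
      MInv aInv aW hMInv haInv haW hunitX hsym hunitA (hparB_parBY f G) hb₁ C₀ hC₀ hreg335P hC37G cVar hcVar hvarB hMd mN hnbr d261 h261)
  have hGa := stepPos_KSCU_of_KSC P f c35 G b ιB C38 (fun j => parSymY (f j).toKIdx) _ (fun j => parBY (f j).toKIdx) C37 _ hι hG1 hM₂ hrepr (d + 1)
    (stepGlobPos_KACU_frame_on P f c35 G b ιB C38 (fun j => parSymY (f j).toKIdx) (fun j => parBY (f j).toKIdx) C37 hι hG1 hpar hunit M₂ hM₂ hrepr hcR Cq hCq hC37
      MInv aInv aW hMInv haInv haW hunitX hsym hunitA (hparB_parBY f G) hb₁ C₀ hC₀ hreg335P hC37G cVar hcVar hvarB hMd mN hnbr d261 h261)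
  have hH1a := stepPos_KSCU_of_KSC P f c35 G b ιB C38 (fun j => parSymY (f j).toKIdx) _ (fun j => parBY (f j).toKIdx) C37 _ hι hG1 hM₂ hrepr (d + 1)
    (stepH1Pos_KACU_frame_parBY_on P f c35 G (fun j => parSymY (f j).toKIdx) b ιB C37 C38 hι hG1 hpar hunit M₂ hM₂ hrepr hcR Cq hCq hC37 MInv aInv aW hMInv
      haInv haW hunitX hsym hunitA hb₁ C₀ hC₀ hreg335P hC37G cVar hcVar hvarB hMd mN hnbr hMr d261 h261)
  have hE4a := stepPos_KSCU_of_KSC P f c35 G b ιB C38 (fun j => parSymY (f j).toKIdx) _ (fun j => parBY (f j).toKIdx) C37 _ hι hG1 hM₂ hrepr (d + 1)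
    (stepE4Pos_KACU_frame_on P f c35 G (fun j => parSymY (f j).toKIdx) (fun j => parBY (f j).toKIdx) b ιB C37 C38 hι hG1 hpar hunit M₂ hM₂ hrepr hcR Cq hCq hC37
      MInv aInv aW hMInv haInv haW hunitX hsym hunitA (hparB_parBY f G) hb₁ C₀ hC₀ hreg335P hC37G cVar hcVar hvarB hMd mN hnbr d261 h261)
  have hH2a := stepPos_KSCU_of_KSC P f c35 G b ιB C38 (fun j => parSymY (f j).toKIdx) _ (fun j => parBY (f j).toKIdx) C37 _ hι hG1 hM₂ hrepr (d + 1)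
    (stepH2Pos_KACU_frame_on P f c35 G (fun j => parSymY (f j).toKIdx) (fun j => parBY (f j).toKIdx) b ιB C37 C38 hι hG1 hpar hunit M₂ hM₂ hrepr hcR Cq hCq hC37
      MInv aInv aW hMInv haInv haW hunitX hsym hunitA (hparB_parBY f G) hb₁ C₀ hC₀ hreg335P hC37G cVar hcVar hvarB hMd mN hnbr d261 h261)
  have hLa := stepPos_KSCU_of_KSC P f c35 G b ιB C38 (fun j => parSymY (f j).toKIdx) _ (fun j => parBY (f j).toKIdx) C37 _ hι hG1 hM₂ hrepr (d + 1)
    (stepL2Pos_KACU_frame₈_on P f c35 G (fun j => parSymY (f j).toKIdx) (fun j => parBY (f j).toKIdx) b ιB C37 C38 hι hG1 hpar hunit M₂ hM₂ hrepr hcR Cq hCq hC37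
      MInv aInv aW hMInv haInv haW hunitX hsym hunitA (hparB_parBY f G) hb₁ C₀ hC₀ hreg335P hC37G cVar hcVar hvarB hMd mN hnbr
      (read377L2_gFrame₅CodedOn P f c35 G (fun j => parSymY (f j).toKIdx) (fun j => parBY (f j).toKIdx) b ιB C37 C38 hι hG1 hpar hunit M₂ hM₂ hrepr hcR Cq hCq
        hC37 MInv aInv aW hMInv haInv haW hunitX hsym hunitA (hparB_parBY f G) hb₁ C₀ hC₀ hreg335P hC37G cVar hcVar hvarB hMd mN hnbr) d261 h261)
  -- the G′ side: dag-n06-c's eight `KSCU` members at `par := parSymY`, `OA := GAY …`, `Cinv := CinvY …`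
  exact sectBStepPrinted_of_posBlockSteps (fun j => modelSignsOn_geo9K (f j).toKIdx)
    (thm32Printed_codedU P f c35 G C38 C37 _ (d + 1) h32) (thm33Printed_codedU P f c35 G C38 (fun j => parSymY (f j).toKIdx) _ (fun j => parBY (f j).toKIdx) C37 h33)
    (stepAnalyticPos_KSCU_on P f c35 G (fun j => parSymY (f j).toKIdx) _ (fun j => parBY (f j).toKIdx) b ιB C37 C38 _ hι hG1 hpar hunit (d + 1) M₂ hM₂ hrepr hcR Cq
      hCq hC37 MInv aInv aW hMInv haInv haW)
    (stepEPos_KSCU_on P f c35 G (fun j => parSymY (f j).toKIdx) _ (fun j => parBY (f j).toKIdx) b ιB C37 C38 _ hι hG1 hpar hunit (d + 1) M₂ hM₂ hrepr hcR Cq hCq hC37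
      MInv aInv aW hMInv haInv haW)
    (stepL2Pos_KSCU_on P f c35 G (fun j => parSymY (f j).toKIdx) _ (fun j => parBY (f j).toKIdx) b ιB C37 C38 _ hι hG1 hpar hunit (d + 1) M₂ hM₂ hrepr hcR hcL Cq hCq
      hC37 MInv aInv aW hMInv haInv haW hcP hplaq)
    (stepGlobPos_KSCU_on P f c35 G (fun j => parSymY (f j).toKIdx) _ (fun j => parBY (f j).toKIdx) b ιB C37 C38 _ hι hG1 hpar hunit (d + 1) M₂ hM₂ hrepr hcR Cq hCq
      hC37 MInv aInv aW hMInv haInv haW)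
    (stepH1Pos_KSCU_parSymY_on P f c35 G _ (fun j => parBY (f j).toKIdx) b ιB C37 C38 _ hι hG1 hpar hunit (d + 1) M₂ hM₂ hrepr hcR Cq hCq hC37 MInv aInv aW hMInv
      haInv haW)
    (stepE4Pos_KSCU_on P f c35 G (fun j => parSymY (f j).toKIdx) _ (fun j => parBY (f j).toKIdx) b ιB C37 C38 _ hι hG1 hpar hunit (d + 1) M₂ hM₂ hrepr hcR Cq hCq
      hC37 MInv aInv aW hMInv haInv haW)
    (stepH2Pos_KSCU_on P f c35 G (fun j => parSymY (f j).toKIdx) _ (fun j => parBY (f j).toKIdx) b ιB C37 C38 _ hι hG1 hpar hunit (d + 1) M₂ hM₂ hrepr hcR Cq hCq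
      hC37 MInv aInv aW hMInv haInv haW)
    (stepKerPos_KSCU_parSymY_on P f c35 G _ (fun j => parBY (f j).toKIdx) b ιB C37 C38 hι hG1 hpar hunit M₂ hM₂ hrepr hcR Cq hCq hC37 MInv aInv aW hMInv haInv haW
      hunitX)
    hEa hLa hGa hH1a hE4a hH2a

/-- ★★ **THEOREM 3.4 OF RECORD `Thm34U` (print's reading) on the subfamily at NODE 00's letters** — «Thus Theorem 3.4 is proved, assuming that Theorems 3.1–3.3
hold» (p.407): `B9.thm34_of_sectB` on `sectBStepU_of_members` and the record's Theorems 3.2 ∕ 3.3 read over the coded carrier (§3); same binders.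
[cite: Balaban1985BackgroundPropagators, Thm 3.4 p.400, Sect. B p.407, Thms 3.2–3.3 pp.398–399] -/
theorem thm34U_of_members (hι : ∀ (j : J) (s : BlkY (f j).toKIdx), β (f j).toKIdx.hN (f j).toKIdx.D (f j).toKIdx.hk (ιB j s) = s)
    (hG1 : ∀ u : 𝔸ˣ, u ∈ G → ‖(u : 𝔸)‖ ≤ 1)
    (hpar : ∀ j (U : CfgY 𝔸 (f j).toKIdx), GVal G (f j).toKIdx U → ∀ z w, parSymY (f j).toKIdx U z w ∈ G)
    (hunit : ∀ j (U : CfgY 𝔸 (f j).toKIdx), GVal G (f j).toKIdx U → IsUnit (deltaPrimeAY (f j).toKIdx (parSymY (f j).toKIdx) U))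
    (M₂ : ℝ) (hM₂ : 0 ≤ M₂) (hrepr : ∀ (v : 𝔸) (j : ι), |b.repr v j| ≤ M₂ * ‖v‖) (hcR : 0 < M₂ * ∑ j, ‖b j‖)
    (hcL : 0 < Real.sqrt (Fintype.card ι) * M₂ * ∑ j, ‖b j‖)
    (Cq : ℝ) (hCq : 0 ≤ Cq)
    (hC37 : ∀ j β' U a, C37 j β' U a → GVal G (f j).toKIdx U ∧ CplxLettersY G (f j) (parSymY (f j).toKIdx) (ιB j) Cq β' U a)
    (MInv aInv aW : ℝ) (hMInv : 0 < MInv) (haInv : 0 < aInv) (haW : 0 < aW)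
    (hunitX : ∀ j (U : CfgY 𝔸 (f j).toKIdx), GVal G (f j).toKIdx U →
      IsUnit (XY (f j).toKIdx (parSymY (f j).toKIdx) (GpY (f j).toKIdx (parSymY (f j).toKIdx)) U))
    (hunitA : ∀ j (α₀ : ℝ) (U : CfgY 𝔸 (f j).toKIdx), (bg9YC 𝔸 G P (f j)).Reg335 c35 α₀ U →
      IsUnit (deltaAY (f j).toKIdx (parSymY (f j).toKIdx) (parBY (f j).toKIdx) (GpY (f j).toKIdx (parSymY (f j).toKIdx)) U)) (hb₁ : 0 ≤ b₁)
    (C₀ : ℝ) (hC₀ : 0 ≤ C₀)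
    (hreg335P : ∀ j (α₀ : ℝ) (U : CfgY 𝔸 (f j).toKIdx), MInv ≤ (geo9Y (f j)).M → 0 < α₀ → (geo9Y (f j)).M * α₀ ≤ aInv →
      (bg9YC 𝔸 G P (f j)).Reg335 c35 α₀ U → Reg335PlaqY G (f j) (ιB j) C₀ U)
    (hC37G : ∀ j β' U a, C37 j β' U a → CplxLettersGY G (f j) (ιB j) β' U a)
    (cVar : ℝ) (hcVar : 0 ≤ cVar) (hvarB : ∀ j β' U a, C37 j β' U a → VarParBY (f j).toKIdx (parBY (f j).toKIdx) cVar β' U a)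
    (hMd : 2 * ((d : ℝ) + 1) < MInv) (mN : ℕ) (hnbr : ∀ (j : J) (y' : IBondY (f j).toKIdx), (nbr (geo9Y (f j)) (2 * ((d : ℝ) + 1)) y').card ≤ mN)
    (hMr : rLB d ℓ + 1 < MInv) {cP : ℝ} (hcP : 0 ≤ cP)
    (hplaq : ∀ (j : J) (α₀ : ℝ) (U : CfgY 𝔸 (f j).toKIdx), (bg9YC 𝔸 G P (f j)).Reg335 c35 α₀ U → PlaqLawY (f j) (ιB j) cP U)
    (d261 : ℝ → ℕ)
    (h261 : ∀ (j : J) (δ α : ℝ), 0 < δ → δ ≤ 1 → 9 / 5000 ≤ α → α < 1 →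
      (gFrame₅CodedOn P f c35 G (fun j => parSymY (f j).toKIdx) (fun j => parBY (f j).toKIdx) b ιB C37 C38 hι hG1 hpar hunit M₂ hM₂ hrepr hcR Cq hCq hC37 MInv
        aInv aW hMInv haInv haW hunitX (fun _ U z w => parSymY_inv_symm U z w) hunitA (hparB_parBY f G) hb₁ C₀ hC₀ hreg335P hC37G cVar hcVar hvarB hMd mN
        hnbr).M261 δ ≤ (geo9Y (f j)).M →
      Ineq261 (d261 δ) (toB6 (geo9Y (f j)) 0 True) δ α)
    (h32 : B9.Thm32Printed (d + 1) c35 (fun j => geo9Y (f j)) (fun j => bg9YC 𝔸 G P (f j)) (CinvY P f G (fun j => parSymY (f j).toKIdx)))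
    (h33 : B9.Thm33Printed c35 (fun j => geo9Y (f j)) (fun j => bg9YC 𝔸 G P (f j))
      (fun j => kernelFamilyS (f j).toKIdx (bg9YC 𝔸 G P (f j)) (fun U => U) (GpY (f j).toKIdx (parSymY (f j).toKIdx)) (parSymY (f j).toKIdx))
      (fun j => kernelFamilyB (f j).toKIdx (bg9YC 𝔸 G P (f j)) (fun U => U)
        (GAY (f j).toKIdx (parSymY (f j).toKIdx) (parBY (f j).toKIdx) (GpY (f j).toKIdx (parSymY (f j).toKIdx))) (parBY (f j).toKIdx))) :
    Thm34U P f c35 G b (fun j => parSymY (f j).toKIdx)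
      (fun j => GAY (f j).toKIdx (parSymY (f j).toKIdx) (parBY (f j).toKIdx) (GpY (f j).toKIdx (parSymY (f j).toKIdx))) (fun j => parBY (f j).toKIdx)
      C37 C38 :=
  B9.thm34_of_sectB (d + 1) c35 (fun j => geo9Y (f j)) (fun j => (codingYx P G (f j) (C37 j) (C38 j)).bg)
    (fun j => KSCU P G (f j) (parSymY (f j).toKIdx) (C37 j) (C38 j))
    (fun j => KACU P G (f j) (GAY (f j).toKIdx (parSymY (f j).toKIdx) (parBY (f j).toKIdx) (GpY (f j).toKIdx (parSymY (f j).toKIdx))) (parBY (f j).toKIdx) (C37 j) (C38 j))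
    (fun j => pullS (codingYx P G (f j) (C37 j) (C38 j)) (CinvY P f G (fun j => parSymY (f j).toKIdx) j)) (fun j => IsAnKY P G (f j) (parSymY (f j).toKIdx) b (C37 j) (C38 j))
    (sectBStepU_of_members P f c35 G b ιB C38 C37 hι hG1 hpar hunit M₂ hM₂ hrepr hcR hcL Cq hCq hC37 MInv aInv aW hMInv haInv haW hunitX hunitA hb₁ C₀ hC₀ hreg335P hC37G cVar hcVar hvarB hMd mN hnbr hMr hcP hplaq d261 h261 h32 h33)
    (thm32Printed_codedU P f c35 G C38 C37 _ (d + 1) h32) (thm33Printed_codedU P f c35 G C38 (fun j => parSymY (f j).toKIdx) _ (fun j => parBY (f j).toKIdx) C37 h33)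

end Assembly

end General


/-! ## §6 ★★★ The matrix algebra `M_N(ℂ)`, `G ≦ U(N)`, coded class `C37GY`: the G′-side laws and the class dictionaries DISCHARGED -/

section Unitary

open scoped Matrix.Norms.L2Operator
open B9Thm311DeltaPrimePos (isUnit_deltaPrimeAY_parSymY)
open B9Thm311PosAtRecordV4 (isUnit_XY_parSymY)
open Node00 (parSymY_mem)

variable {N : ℕ} (P : RegExtraY d ℓ hd hL b₀ b₁ Mstar (Matrix (Fin N) (Fin N) ℂ)) {J : Type} (f : J → MemberY d ℓ hd hL b₀ b₁ Mstar) [∀ x : MemberY d ℓ hd hL b₀ b₁ Mstar, Fintype (geo9Y x).Site]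
  [instDS : ∀ x : MemberY d ℓ hd hL b₀ b₁ Mstar, DecidableEq (geo9Y x).Site] [instNE : ∀ x : MemberY d ℓ hd hL b₀ b₁ Mstar, Nonempty (geo9Y x).Site]
  (c35 : ℝ) (G : Subgroup (Matrix (Fin N) (Fin N) ℂ)ˣ) {ι : Type} [Fintype ι] [DecidableEq ι] (b : Module.Basis ι ℝ (Matrix (Fin N) (Fin N) ℂ))
  (ιB : ∀ j : J, BlkY (f j).toKIdx → IBondY (f j).toKIdx)
  (C38 : ∀ j : J, ℝ → CfgY (Matrix (Fin N) (Fin N) ℂ) (f j).toKIdx → AfldY (Matrix (Fin N) (Fin N) ℂ) (f j).toKIdx → Prop)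

/-- ★★★ **`SectBStepU` AT THE RECORD's LETTERS FOR `𝔸 = M_N(ℂ)`, `G ≦ U(N)`, CODED CLASS `C37GY`** (`Cq = 4(d+1)e^{3(d+1)/2}`, `cVar = cVarGY d ℓ`): §4 with the
G′-side laws DISCHARGED (`hpar` by `Node00.parSymY_mem`, `hunit` by `isUnit_deltaPrimeAY_parSymY`, `hunitX` by `isUnit_XY_parSymY` — Theorem 3.11's positivity) and
the class dictionaries DISCHARGED (`hC37 ∕ hC37G ∕ hvarB` = the projections of dag-n06-c's `B9SectBCodedClassGY`).  STILL DISPLAYED: structural `hι hG1 b M₂ hrepr hcR hcL`,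
positivity data `MInv aInv aW`, the G-side law `hunitA` (Theorem 3.1's input), `hb₁ C₀ hreg335P` ((3.35) on plaquettes), the cell numerics `hMd mN hnbr hMr`, the L² plaquette
law `hplaq`, the Lemma-2.1 datum `(d261, h261)`, the record's Theorems 3.2 ∕ 3.3 `h32 h33`. [cite: Balaban1985BackgroundPropagators, Thm 3.4 p.400, Sect. B pp.400–407, p.407, Thm 3.11 p.416, p.395, (3.35)–(3.37) p.396; Balaban1984PropagatorsII, Lemma 2.1 p.234, (2.45) p.231, (2.51) p.232] -/
theorem sectBStepU_C37GY_unitary_of_members [NormOneClass (Matrix (Fin N) (Fin N) ℂ)] [FiniteDimensional ℝ (Matrix (Fin N) (Fin N) ℂ)]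
    (hG : G ≤ B7Prop2Explicit.unitaryUnits (Matrix (Fin N) (Fin N) ℂ))
    (hι : ∀ (j : J) (s : BlkY (f j).toKIdx), β (f j).toKIdx.hN (f j).toKIdx.D (f j).toKIdx.hk (ιB j s) = s)
    (hG1 : ∀ u : (Matrix (Fin N) (Fin N) ℂ)ˣ, u ∈ G → ‖(u : Matrix (Fin N) (Fin N) ℂ)‖ ≤ 1)
    (M₂ : ℝ) (hM₂ : 0 ≤ M₂) (hrepr : ∀ (v : Matrix (Fin N) (Fin N) ℂ) (j : ι), |b.repr v j| ≤ M₂ * ‖v‖) (hcR : 0 < M₂ * ∑ j, ‖b j‖)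
    (hcL : 0 < Real.sqrt (Fintype.card ι) * M₂ * ∑ j, ‖b j‖)
    (MInv aInv aW : ℝ) (hMInv : 0 < MInv) (haInv : 0 < aInv) (haW : 0 < aW)
    (hunitA : ∀ j (α₀ : ℝ) (U : CfgY (Matrix (Fin N) (Fin N) ℂ) (f j).toKIdx), (bg9YC (Matrix (Fin N) (Fin N) ℂ) G P (f j)).Reg335 c35 α₀ U →
      IsUnit (deltaAY (f j).toKIdx (parSymY (f j).toKIdx) (parBY (f j).toKIdx) (GpY (f j).toKIdx (parSymY (f j).toKIdx)) U)) (hb₁ : 0 ≤ b₁)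
    (C₀ : ℝ) (hC₀ : 0 ≤ C₀)
    (hreg335P : ∀ j (α₀ : ℝ) (U : CfgY (Matrix (Fin N) (Fin N) ℂ) (f j).toKIdx), MInv ≤ (geo9Y (f j)).M → 0 < α₀ → (geo9Y (f j)).M * α₀ ≤ aInv →
      (bg9YC (Matrix (Fin N) (Fin N) ℂ) G P (f j)).Reg335 c35 α₀ U →
        Reg335PlaqY G (f j) (ιB j) C₀ U)
    (hMd : 2 * ((d : ℝ) + 1) < MInv) (mN : ℕ) (hnbr : ∀ (j : J) (y' : IBondY (f j).toKIdx), (nbr (geo9Y (f j)) (2 * ((d : ℝ) + 1)) y').card ≤ mN)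
    (hMr : rLB d ℓ + 1 < MInv) {cP : ℝ} (hcP : 0 ≤ cP)
    (hplaq : ∀ (j : J) (α₀ : ℝ) (U : CfgY (Matrix (Fin N) (Fin N) ℂ) (f j).toKIdx), (bg9YC (Matrix (Fin N) (Fin N) ℂ) G P (f j)).Reg335 c35 α₀ U →
      PlaqLawY (f j) (ιB j) cP U)
    (d261 : ℝ → ℕ)
    (h261 : ∀ (j : J) (δ α : ℝ), 0 < δ → δ ≤ 1 → 9 / 5000 ≤ α → α < 1 →
      (gFrame₅CodedOn P f c35 G (fun j => parSymY (f j).toKIdx) (fun j => parBY (f j).toKIdx) b ιB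
        (fun j => C37GY G (f j) (ιB j) (4 * ((d : ℝ) + 1) * Real.exp (3 * (((d : ℝ) + 1) / 2)))) C38 hι hG1 (fun j _ hU z w => parSymY_mem (f j).toKIdx hU z w)
        (fun j _ hU => isUnit_deltaPrimeAY_parSymY (f j).toKIdx hG hU) M₂ hM₂ hrepr hcR (4 * ((d : ℝ) + 1) * Real.exp (3 * (((d : ℝ) + 1) / 2)))
        (by positivity) (fun j => hC37_of_C37GY G (f j) (ιB j) _) MInv aInv aW hMInv haInv haW (fun j _ hU => isUnit_XY_parSymY (f j).toKIdx hG hU)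
        (fun _ U z w => parSymY_inv_symm U z w) hunitA (hparB_parBY f G) hb₁ C₀ hC₀ hreg335P (fun j => hC37G_of_C37GY G (f j) (ιB j) _) (cVarGY d ℓ)
        (cVarGY_nonneg d ℓ) (fun j => hvarB_of_C37GY G (f j) (ιB j) _) hMd mN hnbr).M261 δ ≤ (geo9Y (f j)).M →
      Ineq261 (d261 δ) (toB6 (geo9Y (f j)) 0 True) δ α)
    (h32 : B9.Thm32Printed (d + 1) c35 (fun j => geo9Y (f j)) (fun j => bg9YC (Matrix (Fin N) (Fin N) ℂ) G P (f j)) (CinvY P f G (fun j => parSymY (f j).toKIdx)))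
    (h33 : B9.Thm33Printed c35 (fun j => geo9Y (f j)) (fun j => bg9YC (Matrix (Fin N) (Fin N) ℂ) G P (f j))
      (fun j => kernelFamilyS (f j).toKIdx (bg9YC (Matrix (Fin N) (Fin N) ℂ) G P (f j)) (fun U => U) (GpY (f j).toKIdx (parSymY (f j).toKIdx))
        (parSymY (f j).toKIdx))
      (fun j => kernelFamilyB (f j).toKIdx (bg9YC (Matrix (Fin N) (Fin N) ℂ) G P (f j)) (fun U => U)
        (GAY (f j).toKIdx (parSymY (f j).toKIdx) (parBY (f j).toKIdx) (GpY (f j).toKIdx (parSymY (f j).toKIdx))) (parBY (f j).toKIdx))) :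
    SectBStepU P f (d + 1) c35 G b (fun j => parSymY (f j).toKIdx)
      (fun j => GAY (f j).toKIdx (parSymY (f j).toKIdx) (parBY (f j).toKIdx) (GpY (f j).toKIdx (parSymY (f j).toKIdx))) (fun j => parBY (f j).toKIdx)
      (fun j => C37GY G (f j) (ιB j) (4 * ((d : ℝ) + 1) * Real.exp (3 * (((d : ℝ) + 1) / 2)))) C38 (CinvY P f G (fun j => parSymY (f j).toKIdx)) :=
  sectBStepU_of_members P f c35 G b ιB C38 (fun j => C37GY G (f j) (ιB j) (4 * ((d : ℝ) + 1) * Real.exp (3 * (((d : ℝ) + 1) / 2)))) hι hG1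
    (fun j _ hU z w => parSymY_mem (f j).toKIdx hU z w) (fun j _ hU => isUnit_deltaPrimeAY_parSymY (f j).toKIdx hG hU) M₂ hM₂ hrepr hcR hcL _ (by positivity)
    (fun j => hC37_of_C37GY G (f j) (ιB j) _) MInv aInv aW hMInv haInv haW (fun j _ hU => isUnit_XY_parSymY (f j).toKIdx hG hU) hunitA hb₁ C₀ hC₀ hreg335P
    (fun j => hC37G_of_C37GY G (f j) (ιB j) _) (cVarGY d ℓ) (cVarGY_nonneg d ℓ) (fun j => hvarB_of_C37GY G (f j) (ιB j) _) hMd mN hnbr hMr hcP hplaq d261 h261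
    h32 h33

end Unitary

end Literature.MathematicalPhysics.QuantumFieldTheory.Balaban1983to89.B9SectBStepUOfMembersR

end
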